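import Summits.Ventures.QEC.Census.BB.BB90.Cert
import Summits.Ventures.QEC.Census.BB.BB90KBRank
import Summits.Ventures.QEC.Theses.BB90DistanceCertificate
import HarnessLib

/-!
# Route BB90DistanceCertificate, item WeightTenZLogical (stmt-Ventures-19782): `BB.bb90` (`QC(x⁹+y+y², 1+x²+x⁷)` on
# `ℤ₁₅ × ℤ₃`, the `[[90,8,10]]` CLAIM) has a `Z`-logical of weight exactly `10`

The kernel-A certificate `cert/BB90.certA.json` (id `a5d2f23c…`, qec-search-1; `BB90.cert : DistCert` emitted with
qec-search-7's emitter, `Census/BB/BB90/Cert.lean`) lists the upper witness `upper.witness_Z` (weight 10, zero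
`H^X`-syndrome) with its NON-MEMBERSHIP witness (`H^Z u = 0`, odd overlap ⇒ `w ∉ rowspace H^Z`, type-02's
`not_mem_rowSpace_of_witness`). Type-10's `upperOK` is evaluated by `decide +kernel`, `upper_sound` gives the flat
witness; the index identity goes through qec-type-11's `BB90KBRank.lean` (`maskMatrix 90 hxMask = BB.bb90.HXFlat`, the
same words), and type-05's `BB.Code.zWitness_of_flat` transports to the typed code. Tier KERNEL, axioms standard.
This certifies `d_Z(BB.bb90) ≤ 10`; the lower bound is item NoZLogicalBelowTen.
-/

namespace Summit.Ventures.QEC.Census.BB90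

open Matrix Literature.InformationTheory.QuantumCodes Summit.Ventures.QEC.Census.LRATBridge
  Summit.Ventures.QEC.Census.BB90KB

/-- The `Z`-side upper check passes (kernel `decide`): the witness has zero `H^X`-syndrome and weight `10`, the
non-membership witness has zero `H^Z`-syndrome and odd overlap with it. -/
theorem upperZ_ok90 :
    upperOK BB90.cert.n BB90.cert.HX BB90.cert.HZ BB90.cert.sideZ.d BB90.cert.sideZ.witness BB90.cert.sideZ.nonmember =
      true := by
  decide +kernel

/-- The certificate's `H^X` rows are qec-type-11's `hxMask` words (the same numerals), entry for entry. -/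
theorem rowMatrix_HX_eq : rowMatrix cert.n cert.HX = maskMatrix 90 hxMask := by
  ext i j
  decide +kernel +revert

/-- The certificate's `H^Z` rows are `hzMask`, entry for entry. -/
theorem rowMatrix_HZ_eq : rowMatrix cert.n cert.HZ = maskMatrix 90 hzMask := by
  ext i j
  decide +kernel +revert

/-- The certificate's `H^X` IS the typed code's flat `H^X`. -/
theorem HX_eq_flat : rowMatrix cert.n cert.HX = BB.bb90.HXFlat :=
  rowMatrix_HX_eq.trans bb90_HXFlat_eq_maskMatrix.symm

/-- The certificate's `H^Z` IS the typed code's flat `H^Z`. -/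
theorem HZ_eq_flat : rowMatrix cert.n cert.HZ = BB.bb90.HZFlat :=
  rowMatrix_HZ_eq.trans bb90_HZFlat_eq_maskMatrix.symm

/-- Commutation of the certificate's matrices, inherited from the typed code through the index identity. -/
theorem comm_flat90 : rowMatrix BB90.cert.n BB90.cert.HX * (rowMatrix BB90.cert.n BB90.cert.HZ)ᵀ = 0 := by
  rw [HX_eq_flat, HZ_eq_flat]
  exact BB.bb90.HXFlat_mul_HZFlat_transpose

/-- **Item WeightTenZLogical, PROVED**: some `Z`-type logical operator of `BB.bb90` has Hamming weight exactly `10`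
— the certificate's upper witness, checked in the kernel and transported to the typed code. -/
theorem weightTenZLogical_proof : Summit.Ventures.QEC.Theses.BB90DistanceCertificate.WeightTenZLogical := by
  obtain ⟨hv, hv', hwt⟩ := upper_sound upperZ_ok90
  exact BB.bb90.zWitness_of_flat (D := CSSCode.ofMatrices (rowMatrix cert.n cert.HX) (rowMatrix cert.n cert.HZ) comm_flat90)
    HX_eq_flat HZ_eq_flat ⟨ofBits cert.n cert.sideZ.witness, hv, hv', hwt⟩

end Summit.Ventures.QEC.Census.BB90
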